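import Summits.QuantumFields.BalabanUV.Beta.GAN24.T2DevCovariance
import Summits.QuantumFields.BalabanUV.Beta.GAN24.T2RecChargeStepMap
import Summits.QuantumFields.BalabanUV.Beta.GAN24.FirstDiffSymCharge

/-!
# `BalabanUV.Beta.GAN24.T2UndressedCombChargeStep` — binder row G-an2-4 ∕ (CONV-C), CT-W: **THE AFFINE STEP AND THE EXACT CHARGE RECURSION OF THE UNDRESSED-KERNEL
# COMB-SLOT REFERENCE TOWER** `T_j := unitS₂_j (T2RecOf d Lc (KInvStep Lc ·) (SpureRecAt d Lc ρ cE cVH cΛ) (M1At d Lc ρ cΛ) cE₂ cB Tc vh₂S (mixFFAt ρ Lc) j)` — the affine step, the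
# exact one-step charge recursion `Z_N(T_{j+1}) = Z_N(b_j) + λ₀-action on Sym Z(T_j)`, and the first difference's `ZfreeSym` at the EXACT pin (road W3's `hZ0` slot of
# END #2 in the `ZfreeSym` currency); generic `d`, any in-block root; PART 1 of the (U-drift) rows (PART 2 = `T2UndressedCombDriftRows`: `hZf`, `hf`)

NOT IN PRINT; OUR PROOF ATTEMPT (G-an2-4 formalisation swarm, leaf prover `b2b-balaban-gan24-formalise-leaf-04` gen 59, crux team (2); the OWNER gan24-p1 g23's
word l.38063 (c): «(U-drift) = W3's END #2 at YOUR reference tower (B) — natural next twin»; RULING R-gan24p1-g23-3 (v) «UNCONDITIONAL work continues … (U) rows»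
and R6 l.38432 «every transport estimate must be an UNDRESSED one»; names PROVISIONAL).  HONEST FRAMING (cell contract, verbatim): «discharging `BetaPertH` makes
Bałaban's UV stability UNCONDITIONAL — a real constructive-QFT result; it is NOT the continuum limit and NOT the Clay problem.»  HONEST DEPENDENCY (verbatim):
«continuum YM on T⁴ ⇐ BetaPertH ∧ nine spine estimates (0/9 proved); BetaPertH ⇐ (D1) ∧ (D4) ∧ CAP+tail; G-an2-4 gates asym, D1 and NE2/3/4.»

WHAT ([folklore] algebra + compositions BY NAME over tree theorems — the comb-slot twin of road W3's difference-tower rows for an2's Stage-B `T2Of`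
(leaf-18's `ChargeStepSym` ∕ `Lin4ZeroMode` ∕ `WSlotForcingZeroModeW3`, leaf-12's `FirstDiffSymCharge`, leaf-05's `W3ForcingRate`); the kernel legs are the SAME
undressed unit resolvents `K♮_j`, only the slots (`SpureRecAt`∕`M1At` at the root `toSite r`) and the generic off-diagonal border `vh₂S` differ; 0 `def`, 0 cite,
0 `def … : Prop`, 0 sorry):
* §1 `shape_lin4_member` (per level; the member ∕ source shapes are gan24-p2 g36's `T2RecChargeStepMap.shape_memberB` ∕ `shape_sourceB` and the affine step
  `T_{j+1} = 𝒜_j T_j + b_j` is leaf-01 g62's `T2DevCovariance.succ_comb_undressed` ≡ p2's `succ_eq_lin4_add_B`, all BY NAME);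
* §2 **`zmode_succ_eq`** — `Z_N(T_{j+1})(μ,ν) = Z_N(b_j)(μ,ν) + N^{d+1}·K·(Z_{Lc}(T_j)(μ,ν) + Z_{Lc}(T_j)(ν,μ))` = p2's affine-map law `zmode_stepB_eq` AT THE
  MEMBER `X := T_j` (covariant by leaf-01's `T2DevCovariance.unitS₂_T2RecOfK_translate`; border covariance `hBt` displayed);
* §3 **`symZ_firstDiff_eq`** ∕ **`hZ0_symZ_of_pinEq`** — at the EXACT pin `cE₂ = Lc^{d+5}` (`= (Lc:ℝ)^(2*(3+1))` at `d = 3`) and F2a-comb at `m = 0`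
  the first difference `D_0 = T_1 − T_0` is `ZfreeSym` (`Sym Z(D_0) = Sym Z(b_0) + (λ₀ − 1)·Sym Z(T_0)`, `λ₀ = cE₂·Lc^{−(d+5)}`) — road W3's `hZ0` slot in the
  `ZfreeSym` currency of `TransportRows.transport_rows_three_symZ` ∕ `rate_three_of_rows_F3b` (END #2 from `D_0`; no «from one» re-cut is needed in this currency);
PART 2 `T2UndressedCombDriftRows` adds the forcing rows `hZf` ∕ `hf`; the d = 3 END («T2Drift» of the reference tower ⟸ F2a-comb ∧ exact pin) is `T2UndressedCombDriftEnd`.  Discharges NOTHING of «T2Shape»(E) ∕ «T2Drift»(E)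
∕ (hW, hWall) of the DRESSED family; NEVER «G-an2-4 closed» as (CONV-C); NOT D1, NOT `BetaPertH`, NOT continuum, NOT Clay; not in print — our bookkeeping.  2026-08-22.
-/

noncomputable section

open Finset
open scoped BigOperators
open Literature.MathematicalPhysics.QuantumFieldTheory
open Literature.MathematicalPhysics.QuantumFieldTheory.Balaban1983to89
open Literature.MathematicalPhysics.QuantumFieldTheory.Balaban1983to89.Beta
open ExpKernelCalculus (MKer Decays shiftK)
open OneStepResolventKernel (Fib LocStencil)
open OneStepKernelFamily (KInvStep decays_KInvStep)
open AffineAveraging (box toSite)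
open AveragingMixedJetTables (mixFFAt)
open SecondOrderResponse (W2SymOfK)
open BalabanCompositeJets (LocStencil₂)
open BalabanStepJetsSucc (mmRead)
open BalabanStepW2 (K3OfK M2Of locStencil₂_smul' locStencil₂_add')
open Summit.QuantumFields.BalabanUV.Beta.HessKerDressedUnits (unitK unitS decays_unitK)
open Summit.QuantumFields.BalabanUV.Beta.SecondOrderUnits (unitM unitS₂ unitM₂)
open Summit.QuantumFields.BalabanUV.Beta.SpineRooted (T2RecOf SpureRecAt M1At locStencil_SpureRecAt vertexFamily_M1At T2RecOf_loc)
open Summit.QuantumFields.BalabanUV.Beta.MixedJetTablesPlug (hmix_an1)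
open Summit.QuantumFields.BalabanUV.Beta.GAN24.CombesThomas (sfStep smStep)
open Summit.QuantumFields.BalabanUV.Beta.GAN24.T2RecursionAffine (lin4)
open Summit.QuantumFields.BalabanUV.Beta.GAN24.BiStencilZeroMode (Tab zmode)
open Summit.QuantumFields.BalabanUV.Beta.GAN24.WSlotFirstDiff (zmode_add zmode_sub locStencil₂_unitS₂)
open Summit.QuantumFields.BalabanUV.Beta.GAN24.WSlotForcingZeroMode (locStencil₂_sub)
open Summit.QuantumFields.BalabanUV.Beta.GAN24.WSlotForcingZeroModeW3 (sub_translate_pi)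
open Summit.QuantumFields.BalabanUV.Beta.GAN24.Lin4ZeroMode (locStencil₂_lin4 zmode_lin4_step)
open Summit.QuantumFields.BalabanUV.Beta.GAN24.FirstDiffSymCharge (pow_charge_factor)
open Summit.QuantumFields.BalabanUV.Beta.GAN24.T2DevCovariance (unitS₂_T2RecOfK_translate succ_comb_undressed)
open Summit.QuantumFields.BalabanUV.Beta.GAN24.T2RecChargeStepMap (shape_memberB shape_sourceB zmode_stepB_eq)

namespace Summit.QuantumFields.BalabanUV.Beta.GAN24.T2UndressedCombChargeStep

variable {d : ℕ} {Lc : ℕ} [NeZero Lc] {r : Fin (d + 1) → ℕ}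

/-! ## §1 Per-level shape of the transported member (member ∕ source shapes: p2's `shape_memberB` ∕ `shape_sourceB`; step: leaf-01's `succ_comb_undressed`) -/

/-- [folklore] **THE LINEAR PART APPLIED TO A MEMBER IS `LocStencil₂`** (per level; `Lin4ZeroMode.locStencil₂_lin4` on gan24-p2's `shape_memberB`), at any step `i`. -/
theorem shape_lin4_member (hLc : 1 ≤ Lc) (hr : r ∈ box (d + 1) Lc) (cE cVH cΛ cE₂ cB : ℝ) (Tc : Fin 4 → Fin 4 → Fin 4 → Fin 4 → ℝ) {vh₂S : Tab d}
    (hB : ∃ C δ : ℝ, 0 < δ ∧ LocStencil₂ vh₂S C δ) (i j : ℕ) :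
    ∃ C δ : ℝ, 0 < δ ∧ LocStencil₂ (lin4 (cE₂ * (Lc : ℝ) ^ (2 * (d + 1))) (unitK (sfStep Lc i) (smStep d Lc i) (KInvStep (d := d) Lc i)) Lc (unitS₂ (sfStep Lc j) (smStep d Lc j) (T2RecOf d Lc (fun j => KInvStep (d := d) Lc j)
        (SpureRecAt d Lc (toSite r) cE cVH cΛ) (M1At d Lc (toSite r) cΛ) cE₂ cB Tc vh₂S (mixFFAt (toSite r) Lc) j))) C δ := by
  obtain ⟨CT, δT, hδT, hT⟩ := shape_memberB hLc hr cE cVH cΛ cE₂ cB Tc hB j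
  obtain ⟨m, C, hm, hC, hK⟩ := decays_KInvStep (Lc := Lc) (d := d) i
  exact ⟨_, _, by positivity, locStencil₂_lin4 (decays_unitK (sf := sfStep Lc i) (sm := smStep d Lc i) hK) (by positivity) hm hLc (cE₂ * (Lc : ℝ) ^ (2 * (d + 1))) hT hδT⟩


/-! ## §2 The exact one-step charge recursion of the reference tower -/

/-- **THE ONE-STEP CHARGE RECURSION OF THE UNDRESSED-KERNEL COMB-SLOT TOWER** [folklore composition; twin of leaf-18's `ChargeStepSym.zmode_succ_eq`], cell form at any
period `N`: `zmode N T_{j+1} (μ,ν;α,β) = zmode N (b_j) (μ,ν;α,β) + N^{d+1}·(cE₂·Lc^{2(d+1)})·½·Lc^{−4(d+2)}·(zmode Lc T_j (μ,ν;α,β) + zmode Lc T_j (ν,μ;α,β))` — the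
UNDRESSED linear part acts on the field–field charge tensor by `λ₀·Sym_bond`: the instance `X := T_j` of gan24-p2 g36's affine-MAP law
`T2RecChargeStepMap.zmode_stepB_eq` BY NAME (member covariance `T2DevCovariance.unitS₂_T2RecOfK_translate`, step `succ_comb_undressed`; border covariance `hBt` displayed).  No four-face read-out (contrast the dressed step, R4b ∕ leaf-01's `zmode_dev_succ`). -/
theorem zmode_succ_eq (hLc : 1 ≤ Lc) (hr : r ∈ box (d + 1) Lc) (N : ℕ) (cE cVH cΛ cE₂ cB : ℝ) (Tc : Fin 4 → Fin 4 → Fin 4 → Fin 4 → ℝ) {vh₂S : Tab d}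
    (hBff : ∀ κ u κ' u' x z (α β : Fin (d + 1)), vh₂S κ u κ' u' x z (Sum.inl α) (Sum.inl β) = 0)
    (hBmm : ∀ κ u κ' u' x z (μ ν : Fin (d + 1)), vh₂S κ u κ' u' x z (Sum.inr μ) (Sum.inr ν) = 0)
    (hB : ∃ C δ : ℝ, 0 < δ ∧ LocStencil₂ vh₂S C δ)
    (hBt : ∀ (κ : Fin (d + 1)) (u : Fin (d + 1) → ℤ) (κ' : Fin (d + 1)) (u' t : Fin (d + 1) → ℤ),
      vh₂S κ (u + (Lc : ℤ) • t) κ' (u' + (Lc : ℤ) • t) = shiftK (-((Lc : ℤ) • t)) (vh₂S κ u κ' u'))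
    (j : ℕ) (μ ν α β : Fin (d + 1)) :
    zmode N (unitS₂ (sfStep Lc (j + 1)) (smStep d Lc (j + 1)) (T2RecOf d Lc (fun j => KInvStep (d := d) Lc j) (SpureRecAt d Lc (toSite r) cE cVH cΛ) (M1At d Lc (toSite r) cΛ) cE₂ cB Tc vh₂S (mixFFAt (toSite r) Lc) (j + 1))) μ ν
        (Sum.inl α) (Sum.inl β)
      = zmode N (fun κ u κ' u' => (cE₂ * (Lc : ℝ) ^ (2 * (d + 1))) • mmRead Lc (K3OfK (unitK (sfStep Lc j) (smStep d Lc j) (KInvStep (d := d) Lc j)) Lc (unitS (sfStep Lc j) (smStep d Lc j) (SpureRecAt d Lc (toSite r) cE cVH cΛ j))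
          (unitM (sfStep Lc j) (smStep d Lc j) (M1At d Lc (toSite r) cΛ j)) (W2SymOfK (unitK (sfStep Lc j) (smStep d Lc j) (KInvStep (d := d) Lc j)) Lc (unitS (sfStep Lc j) (smStep d Lc j) (SpureRecAt d Lc (toSite r) cE cVH cΛ j))
          (unitM (sfStep Lc j) (smStep d Lc j) (M1At d Lc (toSite r) cΛ j)) 0 (unitM₂ (sfStep Lc j) (smStep d Lc j) (M2Of d Lc (mixFFAt (toSite r) Lc) j))) κ u κ' u') + cB • vh₂S κ u κ' u') μ ν (Sum.inl α) (Sum.inl β)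
        + ((N : ℝ) ^ (d + 1)) * (((cE₂ * (Lc : ℝ) ^ (2 * (d + 1))) * ((1 / 2 : ℝ) * (((Lc : ℝ) ^ (d + 1 + 1))⁻¹) ^ 4)) *
          (zmode Lc (unitS₂ (sfStep Lc j) (smStep d Lc j) (T2RecOf d Lc (fun j => KInvStep (d := d) Lc j) (SpureRecAt d Lc (toSite r) cE cVH cΛ) (M1At d Lc (toSite r) cΛ) cE₂ cB Tc vh₂S (mixFFAt (toSite r) Lc) j)) μ ν (Sum.inl α)
              (Sum.inl β)
            + zmode Lc (unitS₂ (sfStep Lc j) (smStep d Lc j) (T2RecOf d Lc (fun j => KInvStep (d := d) Lc j) (SpureRecAt d Lc (toSite r) cE cVH cΛ) (M1At d Lc (toSite r) cΛ) cE₂ cB Tc vh₂S (mixFFAt (toSite r) Lc) j)) ν μ (Sum.inl α)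
                (Sum.inl β))) := by
  obtain ⟨CT, δT, hδT, hT⟩ := shape_memberB hLc hr cE cVH cΛ cE₂ cB Tc hB j
  have hTcov := fun κ u κ' u' t => unitS₂_T2RecOfK_translate (r := r) hLc cE cVH cΛ cE₂ cB Tc hBt j κ u κ' u' t
  rw [succ_comb_undressed hLc hr cE cVH cΛ cE₂ cB Tc hBff hBmm hB j]
  have e' : zmode N (lin4 (cE₂ * (Lc : ℝ) ^ (2 * (d + 1))) (unitK (sfStep Lc j) (smStep d Lc j) (KInvStep (d := d) Lc j)) Lc (unitS₂ (sfStep Lc j) (smStep d Lc j) (T2RecOf d Lc (fun j => KInvStep (d := d) Lc j) (SpureRecAt d Lc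
      (toSite r) cE cVH cΛ) (M1At d Lc (toSite r) cΛ) cE₂ cB Tc vh₂S (mixFFAt (toSite r) Lc) j)) +
        (fun κ u κ' u' => (cE₂ * (Lc : ℝ) ^ (2 * (d + 1))) • mmRead Lc (K3OfK (unitK (sfStep Lc j) (smStep d Lc j) (KInvStep (d := d) Lc j)) Lc (unitS (sfStep Lc j) (smStep d Lc j) (SpureRecAt d Lc (toSite r) cE cVH cΛ j)) (unitM
            (sfStep Lc j) (smStep d Lc j) (M1At d Lc (toSite r) cΛ j)) (W2SymOfK (unitK (sfStep Lc j) (smStep d Lc j) (KInvStep (d := d) Lc j)) Lc (unitS (sfStep Lc j) (smStep d Lc j) (SpureRecAt d Lc (toSite r) cE cVH cΛ j)) (unitM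
            (sfStep Lc j) (smStep d Lc j) (M1At d Lc (toSite r) cΛ j)) 0 (unitM₂ (sfStep Lc j) (smStep d Lc j) (M2Of d Lc (mixFFAt (toSite r) Lc) j))) κ u κ' u') + cB • vh₂S κ u κ' u')) μ ν (Sum.inl α) (Sum.inl β) = _ :=
    zmode_stepB_eq hLc hr cE cVH cΛ cE₂ cB Tc hBff hBmm hB hT hδT hTcov N j μ ν α β
  exact e'

/-! ## §3 The first difference `D_0 = T_1 − T_0` is `ZfreeSym` at the exact pin (road W3's `hZ0` slot, `ZfreeSym` currency) -/

/-- **THE BOND-SYMMETRISED ff CHARGE OF THE FIRST DIFFERENCE** of the reference tower [folklore; twin of leaf-12's `FirstDiffSymCharge.symZ_firstDiff_eq`]: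
`Sym Z(D_0)(μ,ν;α,β) = Sym Z(b_0)(μ,ν;α,β) + (cE₂·(Lc^{d+5})⁻¹ − 1)·Sym Z(T_0)(μ,ν;α,β)` (`zmode_sub` twice, §2 twice at `j = 0`, `N = Lc`, `pow_charge_factor`). -/
theorem symZ_firstDiff_eq (hLc : 1 ≤ Lc) (hr : r ∈ box (d + 1) Lc) (cE cVH cΛ cE₂ cB : ℝ) (Tc : Fin 4 → Fin 4 → Fin 4 → Fin 4 → ℝ) {vh₂S : Tab d}
    (hBff : ∀ κ u κ' u' x z (α β : Fin (d + 1)), vh₂S κ u κ' u' x z (Sum.inl α) (Sum.inl β) = 0)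
    (hBmm : ∀ κ u κ' u' x z (μ ν : Fin (d + 1)), vh₂S κ u κ' u' x z (Sum.inr μ) (Sum.inr ν) = 0)
    (hB : ∃ C δ : ℝ, 0 < δ ∧ LocStencil₂ vh₂S C δ)
    (hBt : ∀ (κ : Fin (d + 1)) (u : Fin (d + 1) → ℤ) (κ' : Fin (d + 1)) (u' t : Fin (d + 1) → ℤ),
      vh₂S κ (u + (Lc : ℤ) • t) κ' (u' + (Lc : ℤ) • t) = shiftK (-((Lc : ℤ) • t)) (vh₂S κ u κ' u'))
    (μ ν α β : Fin (d + 1)) :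
    zmode Lc (fun κ u κ' u' => unitS₂ (sfStep Lc 1) (smStep d Lc 1) (T2RecOf d Lc (fun j => KInvStep (d := d) Lc j) (SpureRecAt d Lc (toSite r) cE cVH cΛ) (M1At d Lc (toSite r) cΛ) cE₂ cB Tc vh₂S (mixFFAt (toSite r) Lc) 1) κ u κ' u' -
        unitS₂ (sfStep Lc 0) (smStep d Lc 0) (T2RecOf d Lc (fun j => KInvStep (d := d) Lc j) (SpureRecAt d Lc (toSite r) cE cVH cΛ) (M1At d Lc (toSite r) cΛ) cE₂ cB Tc vh₂S (mixFFAt (toSite r) Lc) 0) κ u κ' u') μ ν (Sum.inl α)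
        (Sum.inl β)
      + zmode Lc (fun κ u κ' u' => unitS₂ (sfStep Lc 1) (smStep d Lc 1) (T2RecOf d Lc (fun j => KInvStep (d := d) Lc j) (SpureRecAt d Lc (toSite r) cE cVH cΛ) (M1At d Lc (toSite r) cΛ) cE₂ cB Tc vh₂S (mixFFAt (toSite r) Lc) 1) κ u κ'
          u' - unitS₂ (sfStep Lc 0) (smStep d Lc 0) (T2RecOf d Lc (fun j => KInvStep (d := d) Lc j) (SpureRecAt d Lc (toSite r) cE cVH cΛ) (M1At d Lc (toSite r) cΛ) cE₂ cB Tc vh₂S (mixFFAt (toSite r) Lc) 0) κ u κ' u') ν μ (Sum.inl α)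
          (Sum.inl β)
      = (zmode Lc (fun κ u κ' u' => (cE₂ * (Lc : ℝ) ^ (2 * (d + 1))) • mmRead Lc (K3OfK (unitK (sfStep Lc 0) (smStep d Lc 0) (KInvStep (d := d) Lc 0)) Lc (unitS (sfStep Lc 0) (smStep d Lc 0) (SpureRecAt d Lc (toSite r) cE cVH cΛ 0))
          (unitM (sfStep Lc 0) (smStep d Lc 0) (M1At d Lc (toSite r) cΛ 0)) (W2SymOfK (unitK (sfStep Lc 0) (smStep d Lc 0) (KInvStep (d := d) Lc 0)) Lc (unitS (sfStep Lc 0) (smStep d Lc 0) (SpureRecAt d Lc (toSite r) cE cVH cΛ 0))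
          (unitM (sfStep Lc 0) (smStep d Lc 0) (M1At d Lc (toSite r) cΛ 0)) 0 (unitM₂ (sfStep Lc 0) (smStep d Lc 0) (M2Of d Lc (mixFFAt (toSite r) Lc) 0))) κ u κ' u') + cB • vh₂S κ u κ' u') μ ν (Sum.inl α) (Sum.inl β)
          + zmode Lc (fun κ u κ' u' => (cE₂ * (Lc : ℝ) ^ (2 * (d + 1))) • mmRead Lc (K3OfK (unitK (sfStep Lc 0) (smStep d Lc 0) (KInvStep (d := d) Lc 0)) Lc (unitS (sfStep Lc 0) (smStep d Lc 0) (SpureRecAt d Lc (toSite r) cE cVH cΛ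
              0)) (unitM (sfStep Lc 0) (smStep d Lc 0) (M1At d Lc (toSite r) cΛ 0)) (W2SymOfK (unitK (sfStep Lc 0) (smStep d Lc 0) (KInvStep (d := d) Lc 0)) Lc (unitS (sfStep Lc 0) (smStep d Lc 0) (SpureRecAt d Lc (toSite r) cE cVH cΛ
              0)) (unitM (sfStep Lc 0) (smStep d Lc 0) (M1At d Lc (toSite r) cΛ 0)) 0 (unitM₂ (sfStep Lc 0) (smStep d Lc 0) (M2Of d Lc (mixFFAt (toSite r) Lc) 0))) κ u κ' u') + cB • vh₂S κ u κ' u') ν μ (Sum.inl α) (Sum.inl β))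
        + (cE₂ * ((Lc : ℝ) ^ (d + 5))⁻¹ - 1) * (zmode Lc (unitS₂ (sfStep Lc 0) (smStep d Lc 0) (T2RecOf d Lc (fun j => KInvStep (d := d) Lc j) (SpureRecAt d Lc (toSite r) cE cVH cΛ) (M1At d Lc (toSite r) cΛ) cE₂ cB Tc vh₂S (mixFFAt
            (toSite r) Lc) 0)) μ ν (Sum.inl α) (Sum.inl β)
          + zmode Lc (unitS₂ (sfStep Lc 0) (smStep d Lc 0) (T2RecOf d Lc (fun j => KInvStep (d := d) Lc j) (SpureRecAt d Lc (toSite r) cE cVH cΛ) (M1At d Lc (toSite r) cΛ) cE₂ cB Tc vh₂S (mixFFAt (toSite r) Lc) 0)) ν μ (Sum.inl α)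
              (Sum.inl β)) := by
  obtain ⟨C₀, δ₀, hδ₀, h₀⟩ := shape_memberB hLc hr cE cVH cΛ cE₂ cB Tc hB 0
  obtain ⟨C₁, δ₁, hδ₁, h₁⟩ := shape_memberB hLc hr cE cVH cΛ cE₂ cB Tc hB 1
  have hrate : 0 < min δ₀ δ₁ := lt_min hδ₀ hδ₁
  rw [zmode_sub (h₁.mono (min_le_right _ _)) (h₀.mono (min_le_left _ _)) hrate μ ν,
    zmode_sub (h₁.mono (min_le_right _ _)) (h₀.mono (min_le_left _ _)) hrate ν μ,
    zmode_succ_eq hLc hr Lc cE cVH cΛ cE₂ cB Tc hBff hBmm hB hBt 0 μ ν α β, zmode_succ_eq hLc hr Lc cE cVH cΛ cE₂ cB Tc hBff hBmm hB hBt 0 ν μ α β,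
    ← pow_charge_factor (d := d) (Lc := Lc) cE₂]
  ring

/-- **AT THE EXACT PIN `cE₂ = Lc^{d+5}` AND F2a-comb AT `m = 0` THE FIRST DIFFERENCE IS `ZfreeSym`** [folklore; twin of leaf-12's `hZ0_symZ_of_pinEq`]: joint
`Lc`-covariance (`T2DevCovariance.unitS₂_T2RecOfK_translate` twice, `sub_translate_pi`) ∧ `Sym Z(D_0) = 0` — road W3's `hZ0` binder of `TransportRows.rate_three_of_rows_F3b`
at `D 0 := T_1 − T_0`, for EVERY `Tc`, every `cVH cΛ cB`, every off-diagonal covariant border. -/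
theorem hZ0_symZ_of_pinEq (hLc : 1 ≤ Lc) (hr : r ∈ box (d + 1) Lc) (cE cVH cΛ cE₂ cB : ℝ) (Tc : Fin 4 → Fin 4 → Fin 4 → Fin 4 → ℝ) {vh₂S : Tab d}
    (hBff : ∀ κ u κ' u' x z (α β : Fin (d + 1)), vh₂S κ u κ' u' x z (Sum.inl α) (Sum.inl β) = 0)
    (hBmm : ∀ κ u κ' u' x z (μ ν : Fin (d + 1)), vh₂S κ u κ' u' x z (Sum.inr μ) (Sum.inr ν) = 0)
    (hB : ∃ C δ : ℝ, 0 < δ ∧ LocStencil₂ vh₂S C δ)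
    (hBt : ∀ (κ : Fin (d + 1)) (u : Fin (d + 1) → ℤ) (κ' : Fin (d + 1)) (u' t : Fin (d + 1) → ℤ),
      vh₂S κ (u + (Lc : ℤ) • t) κ' (u' + (Lc : ℤ) • t) = shiftK (-((Lc : ℤ) • t)) (vh₂S κ u κ' u'))
    (hpinEq : cE₂ = (Lc : ℝ) ^ (d + 5))
    (hZb0 : ∀ κ κ' κ₁ κ₂ : Fin (d + 1), zmode Lc (fun κ u κ' u' => (cE₂ * (Lc : ℝ) ^ (2 * (d + 1))) • mmRead Lc (K3OfK (unitK (sfStep Lc 0) (smStep d Lc 0) (KInvStep (d := d) Lc 0)) Lc (unitS (sfStep Lc 0) (smStep d Lc 0) (SpureRecAt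
        d Lc (toSite r) cE cVH cΛ 0)) (unitM (sfStep Lc 0) (smStep d Lc 0) (M1At d Lc (toSite r) cΛ 0)) (W2SymOfK (unitK (sfStep Lc 0) (smStep d Lc 0) (KInvStep (d := d) Lc 0)) Lc (unitS (sfStep Lc 0) (smStep d Lc 0) (SpureRecAt d Lc
        (toSite r) cE cVH cΛ 0)) (unitM (sfStep Lc 0) (smStep d Lc 0) (M1At d Lc (toSite r) cΛ 0)) 0 (unitM₂ (sfStep Lc 0) (smStep d Lc 0) (M2Of d Lc (mixFFAt (toSite r) Lc) 0))) κ u κ' u') + cB • vh₂S κ u κ' u') κ κ' (Sum.inl κ₁)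
        (Sum.inl κ₂)
          + zmode Lc (fun κ u κ' u' => (cE₂ * (Lc : ℝ) ^ (2 * (d + 1))) • mmRead Lc (K3OfK (unitK (sfStep Lc 0) (smStep d Lc 0) (KInvStep (d := d) Lc 0)) Lc (unitS (sfStep Lc 0) (smStep d Lc 0) (SpureRecAt d Lc (toSite r) cE cVH cΛ
              0)) (unitM (sfStep Lc 0) (smStep d Lc 0) (M1At d Lc (toSite r) cΛ 0)) (W2SymOfK (unitK (sfStep Lc 0) (smStep d Lc 0) (KInvStep (d := d) Lc 0)) Lc (unitS (sfStep Lc 0) (smStep d Lc 0) (SpureRecAt d Lc (toSite r) cE cVH cΛ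
              0)) (unitM (sfStep Lc 0) (smStep d Lc 0) (M1At d Lc (toSite r) cΛ 0)) 0 (unitM₂ (sfStep Lc 0) (smStep d Lc 0) (M2Of d Lc (mixFFAt (toSite r) Lc) 0))) κ u κ' u') + cB • vh₂S κ u κ' u') κ' κ (Sum.inl κ₁) (Sum.inl κ₂) = 0) :
    (∀ κ u κ' u' t, (fun κ u κ' u' => unitS₂ (sfStep Lc 1) (smStep d Lc 1) (T2RecOf d Lc (fun j => KInvStep (d := d) Lc j) (SpureRecAt d Lc (toSite r) cE cVH cΛ) (M1At d Lc (toSite r) cΛ) cE₂ cB Tc vh₂S (mixFFAt (toSite r) Lc) 1) κ u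
        κ' u' - unitS₂ (sfStep Lc 0) (smStep d Lc 0) (T2RecOf d Lc (fun j => KInvStep (d := d) Lc j) (SpureRecAt d Lc (toSite r) cE cVH cΛ) (M1At d Lc (toSite r) cΛ) cE₂ cB Tc vh₂S (mixFFAt (toSite r) Lc) 0) κ u κ' u') κ (u + (Lc : ℤ)
        • t) κ' (u' + (Lc : ℤ) • t)
        = shiftK (-((Lc : ℤ) • t)) ((fun κ u κ' u' => unitS₂ (sfStep Lc 1) (smStep d Lc 1) (T2RecOf d Lc (fun j => KInvStep (d := d) Lc j) (SpureRecAt d Lc (toSite r) cE cVH cΛ) (M1At d Lc (toSite r) cΛ) cE₂ cB Tc vh₂S (mixFFAt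
            (toSite r) Lc) 1) κ u κ' u' - unitS₂ (sfStep Lc 0) (smStep d Lc 0) (T2RecOf d Lc (fun j => KInvStep (d := d) Lc j) (SpureRecAt d Lc (toSite r) cE cVH cΛ) (M1At d Lc (toSite r) cΛ) cE₂ cB Tc vh₂S (mixFFAt (toSite r) Lc) 0)
            κ u κ' u') κ u κ' u')) ∧
      (∀ κ κ' κ₁ κ₂ : Fin (d + 1), zmode Lc (fun κ u κ' u' => unitS₂ (sfStep Lc 1) (smStep d Lc 1) (T2RecOf d Lc (fun j => KInvStep (d := d) Lc j) (SpureRecAt d Lc (toSite r) cE cVH cΛ) (M1At d Lc (toSite r) cΛ) cE₂ cB Tc vh₂S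
          (mixFFAt (toSite r) Lc) 1) κ u κ' u' - unitS₂ (sfStep Lc 0) (smStep d Lc 0) (T2RecOf d Lc (fun j => KInvStep (d := d) Lc j) (SpureRecAt d Lc (toSite r) cE cVH cΛ) (M1At d Lc (toSite r) cΛ) cE₂ cB Tc vh₂S (mixFFAt (toSite r)
          Lc) 0) κ u κ' u') κ κ' (Sum.inl κ₁) (Sum.inl κ₂)
        + zmode Lc (fun κ u κ' u' => unitS₂ (sfStep Lc 1) (smStep d Lc 1) (T2RecOf d Lc (fun j => KInvStep (d := d) Lc j) (SpureRecAt d Lc (toSite r) cE cVH cΛ) (M1At d Lc (toSite r) cΛ) cE₂ cB Tc vh₂S (mixFFAt (toSite r) Lc) 1) κ u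
            κ' u' - unitS₂ (sfStep Lc 0) (smStep d Lc 0) (T2RecOf d Lc (fun j => KInvStep (d := d) Lc j) (SpureRecAt d Lc (toSite r) cE cVH cΛ) (M1At d Lc (toSite r) cΛ) cE₂ cB Tc vh₂S (mixFFAt (toSite r) Lc) 0) κ u κ' u') κ' κ
            (Sum.inl κ₁) (Sum.inl κ₂) = 0) := by
  have hL : (Lc : ℝ) ^ (d + 5) ≠ 0 := pow_ne_zero _ (Nat.cast_ne_zero.mpr (NeZero.ne Lc))
  refine ⟨fun κ u κ' u' t => ?_, fun κ κ' κ₁ κ₂ => ?_⟩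
  · have h := sub_translate_pi (A := unitS₂ (sfStep Lc 1) (smStep d Lc 1) (T2RecOf d Lc (fun j => KInvStep (d := d) Lc j) (SpureRecAt d Lc (toSite r) cE cVH cΛ) (M1At d Lc (toSite r) cΛ) cE₂ cB Tc vh₂S (mixFFAt (toSite r) Lc) 1))
        (B := unitS₂ (sfStep Lc 0) (smStep d Lc 0) (T2RecOf d Lc (fun j => KInvStep (d := d) Lc j) (SpureRecAt d Lc (toSite r) cE cVH cΛ) (M1At d Lc (toSite r) cΛ) cE₂ cB Tc vh₂S (mixFFAt (toSite r) Lc) 0)) (w := (Lc : ℤ) • t) (v :=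
            -((Lc : ℤ) • t))
        (fun κ u κ' u' => unitS₂_T2RecOfK_translate (r := r) hLc cE cVH cΛ cE₂ cB Tc hBt 1 κ u κ' u' t)
        (fun κ u κ' u' => unitS₂_T2RecOfK_translate (r := r) hLc cE cVH cΛ cE₂ cB Tc hBt 0 κ u κ' u' t) κ u κ' u'
    exact h
  · rw [symZ_firstDiff_eq hLc hr cE cVH cΛ cE₂ cB Tc hBff hBmm hB hBt κ κ' κ₁ κ₂, hZb0, hpinEq, mul_inv_cancel₀ hL, sub_self, zero_mul, add_zero]

end Summit.QuantumFields.BalabanUV.Beta.GAN24.T2UndressedCombChargeStep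

end
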